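import Summits.AnomalousDissipation.AnomalousDissipation.Theorems.SawtoothPulseCascadeK1LocalisedCascadeExactChirp
import Summits.AnomalousDissipation.AnomalousDissipation.Theorems.SawtoothPulseCascadeK1LocalisedCascadeChirpRounding

/-!
# K1loc, line `Spectral` / thin start — helper: THE PHASE-ONE START, FIBRE BY FIBRE (S-D start)

Helper file of the prover lane on the crux `K1LocalisedCascade` (stmt-AnomalousDissipation-19491), route `SawtoothPulseCascade`
(S-B/S-C assembly seat; START `E_{j₀}`, `j₀ = 1`, of the amplitude ledger `K1Ledger.From.k1Localised_of_amplitude_ledger`).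
Continuation of `…PhaseOneModes` (`Σ'W‖𝓕a₁‖² ≤ ½Σ'_{(n,p)}W(p,n)(‖ĝ_n(p+1)‖²‖ĝ_{−1}(n)‖² + ‖ĝ_n(p−1)‖²‖ĝ₁(n)‖²)`):
* §1 weighted `ℓ²` perturbation on the circle: for `‖g − g₀‖ ≤ ε` pointwise and weights `0 ≤ Φ ≤ 1`,
  `√(Σ'Φ‖ĝ‖²) ≤ √(Σ'Φ‖ĝ₀‖²) + ε` (finite and `tsum` forms) — the weights `‖ĝ_{±1}(n)‖²` of the rounded chirp may be
  replaced by those of the EXACT chirp at the price `2πη₁` ONCE (not fibre by fibre);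
* §2 regrouping by fibres: `Σ'W‖𝓕a₁‖² ≤ ½(Σ'_n ‖ĝ_{−1}(n)‖²Φ⁻_n + Σ'_n ‖ĝ₁(n)‖²Φ⁺_n)`, `Φ^∓_n = Σ'_p W(p,n)‖ĝ_n(p±1)‖² ∈ [0,1]`
  (`tsum_weight_sq_norm_phaseOne_le_fibre`), and `Φ_n ≤ Σ_{|q|≤Q}‖ĝ_n(q)‖²` when the tracked set of fibre `n` sits in `|p∓1| ≤ Q`
  (`tsum_weight_chirp_le_lowpass`) — the low-pass energies `…ExactChirp` / `…ChirpRounding` bound;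
* §3 the START INEQUALITY `tsum_weight_sq_norm_phaseOne_le_exact`: for weights `0 ≤ W ≤ 1` and the exact one-tooth chirps `g₀^{±}`
  (`λ = ±G`, hypothesis form of `…SawtoothChirp`) with `|±ψ − (±G)·tri(2π·)/(2π)| ≤ η₁`,
  `Σ'W‖𝓕a₁‖² ≤ ½Σ_{σ=±}(√(Σ'_n‖ĝ₀^{σ}(n)‖²Φ^σ_n) + 2πη₁)²`.
No definitions; nothing about the crux. [cite: Grafakos2014, Prop. 3.1.2 (5) and Prop. 3.2.7 (3)] [problem: turb]
-/

-- `Summit.<Summit>.<Problem>`: single-conjunct summit, the duplicate namespace segment is deliberate.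
set_option linter.dupNamespace false

noncomputable section

namespace Summit.AnomalousDissipation.AnomalousDissipation.Theorems.SawtoothPulseCascade.K1Start

open MeasureTheory Set Filter Topology UnitAddTorus Function Complex AddCircle
open scoped Real
open Literature.Analysis Literature.Analysis.FunctionSpaces Literature.Analysis.FunctionSpaces.Torus Literature.Analysis.FluidPDE
open Literature.Analysis.FluidPDE.SawtoothCascade

/-! ## §1 Weighted `ℓ²` perturbation on the circle -/

/-- The Fourier coefficients of a continuous circle function are square summable (Parseval). [cite: Grafakos2014, Prop. 3.2.7 (3)] -/
theorem summable_sq_norm_fourierCoeff_of_continuous {h : UnitAddCircle → ℂ} (hc : Continuous h) :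
    Summable fun q : ℤ => ‖fourierCoeff h q‖ ^ 2 := by
  obtain ⟨B, hB⟩ := (isCompact_univ.image hc).isBounded.exists_norm_le
  have hB' : ∀ x, ‖h x‖ ≤ B := fun x => hB _ ⟨x, mem_univ _, rfl⟩
  have hmem : MemLp h 2 haarAddCircle :=
    (memLp_top_of_bound hc.aestronglyMeasurable B (Eventually.of_forall hB')).mono_exponent le_top
  have hP := hasSum_sq_fourierCoeff (hmem.toLp _)
  have hcoe : ∀ p, fourierCoeff (hmem.toLp _) p = fourierCoeff h p := by
    intro p
    simp only [fourierCoeff]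
    exact integral_congr_ae (by filter_upwards [MemLp.coeFn_toLp hmem] with x hx; simp only [hx])
  simp_rw [hcoe] at hP
  exact hP.summable

/-- **Weighted Minkowski–Bessel, finite form**: `‖g − g₀‖ ≤ ε` pointwise and `0 ≤ Φ ≤ 1` give
`√(Σ_{q∈S}Φ(q)‖ĝ(q)‖²) ≤ √(Σ_{q∈S}Φ(q)‖ĝ₀(q)‖²) + ε`. [cite: Grafakos2014, Prop. 3.2.7 (3)] -/
theorem sqrt_sum_weight_sq_norm_fourierCoeff_le_of_near {g g₀ : UnitAddCircle → ℂ} (hg : Continuous g)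
    (hg₀ : Continuous g₀) {ε : ℝ} (hε : ∀ x, ‖g x - g₀ x‖ ≤ ε) {Φ : ℤ → ℝ} (hΦ0 : ∀ q, 0 ≤ Φ q) (hΦ1 : ∀ q, Φ q ≤ 1)
    (S : Finset ℤ) :
    Real.sqrt (∑ q ∈ S, Φ q * ‖fourierCoeff g q‖ ^ 2) ≤ Real.sqrt (∑ q ∈ S, Φ q * ‖fourierCoeff g₀ q‖ ^ 2) + ε := by
  have hε0 : 0 ≤ ε := (norm_nonneg _).trans (hε 0)
  set h : UnitAddCircle → ℂ := fun x => g x - g₀ x with hh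
  have hhc : Continuous h := hg.sub hg₀
  have hint : ∀ (f : UnitAddCircle → ℂ), Continuous f → ∀ q : ℤ,
      Integrable (fun x : UnitAddCircle => (fourier (-q) x : ℂ) • f x) haarAddCircle := fun f hf q =>
    ((fourier (-q)).continuous.smul hf).integrable_of_hasCompactSupport (HasCompactSupport.of_compactSpace _)
  have hsub : ∀ q, fourierCoeff g q = fourierCoeff g₀ q + fourierCoeff h q := by
    intro q
    simp only [fourierCoeff]
    rw [← integral_add (hint g₀ hg₀ q) (hint h hhc q)]
    refine integral_congr_ae (Eventually.of_forall fun x => ?_)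
    simp only [hh, smul_eq_mul]; ring
  set a : ℤ → ℝ := fun q => Real.sqrt (Φ q) * ‖fourierCoeff g₀ q‖ with ha
  set b : ℤ → ℝ := fun q => Real.sqrt (Φ q) * ‖fourierCoeff h q‖ with hb
  have ha2 : ∀ q, a q ^ 2 = Φ q * ‖fourierCoeff g₀ q‖ ^ 2 := fun q => by rw [ha, mul_pow, Real.sq_sqrt (hΦ0 q)]
  have hb2 : ∀ q, b q ^ 2 = Φ q * ‖fourierCoeff h q‖ ^ 2 := fun q => by rw [hb, mul_pow, Real.sq_sqrt (hΦ0 q)]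
  set A := Real.sqrt (∑ q ∈ S, a q ^ 2) with hA
  set B := Real.sqrt (∑ q ∈ S, b q ^ 2) with hB
  have hA0 : 0 ≤ A := Real.sqrt_nonneg _
  have hB0 : 0 ≤ B := Real.sqrt_nonneg _
  have hA2 : A ^ 2 = ∑ q ∈ S, a q ^ 2 := Real.sq_sqrt (Finset.sum_nonneg fun q _ => sq_nonneg _)
  have hB2 : B ^ 2 = ∑ q ∈ S, b q ^ 2 := Real.sq_sqrt (Finset.sum_nonneg fun q _ => sq_nonneg _)
  have hCS : (∑ q ∈ S, a q * b q) ^ 2 ≤ (∑ q ∈ S, a q ^ 2) * ∑ q ∈ S, b q ^ 2 :=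
    Finset.sum_sq_le_sum_mul_sum_of_sq_le_mul S (fun q _ => sq_nonneg (a q)) (fun q _ => sq_nonneg (b q))
      fun q _ => le_of_eq (by ring)
  have hab : ∑ q ∈ S, a q * b q ≤ A * B := by
    have h0 : 0 ≤ ∑ q ∈ S, a q * b q := Finset.sum_nonneg fun q _ => mul_nonneg (by positivity) (by positivity)
    rw [← hA2, ← hB2, ← mul_pow] at hCS
    exact (pow_le_pow_iff_left₀ h0 (mul_nonneg hA0 hB0) two_ne_zero).mp hCS
  have hle : ∑ q ∈ S, Φ q * ‖fourierCoeff g q‖ ^ 2 ≤ (A + B) ^ 2 := by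
    calc ∑ q ∈ S, Φ q * ‖fourierCoeff g q‖ ^ 2 ≤ ∑ q ∈ S, (a q + b q) ^ 2 :=
          Finset.sum_le_sum fun q _ => by
            rw [hsub q, ha, hb, ← mul_add, mul_pow, Real.sq_sqrt (hΦ0 q)]
            exact mul_le_mul_of_nonneg_left (pow_le_pow_left₀ (norm_nonneg _) (norm_add_le _ _) 2) (hΦ0 q)
      _ = ∑ q ∈ S, a q ^ 2 + 2 * ∑ q ∈ S, a q * b q + ∑ q ∈ S, b q ^ 2 := by
          rw [Finset.mul_sum, ← Finset.sum_add_distrib, ← Finset.sum_add_distrib]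
          exact Finset.sum_congr rfl fun q _ => by ring
      _ ≤ (A + B) ^ 2 := by rw [← hA2, ← hB2]; nlinarith
  have hBε : B ≤ ε := by
    have h1 : ∑ q ∈ S, b q ^ 2 ≤ ε ^ 2 := by
      calc ∑ q ∈ S, b q ^ 2 ≤ ∑ q ∈ S, ‖fourierCoeff h q‖ ^ 2 :=
            Finset.sum_le_sum fun q _ => by
              rw [hb2]; exact mul_le_of_le_one_left (sq_nonneg _) (hΦ1 q)
        _ ≤ ε ^ 2 := sum_sq_norm_fourierCoeff_le_of_norm_le (h := h) hhc hε S
    calc B = Real.sqrt (∑ q ∈ S, b q ^ 2) := hB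
      _ ≤ Real.sqrt (ε ^ 2) := Real.sqrt_le_sqrt h1
      _ = ε := Real.sqrt_sq hε0
  have hAe : A = Real.sqrt (∑ q ∈ S, Φ q * ‖fourierCoeff g₀ q‖ ^ 2) := by
    rw [hA]; congr 1; exact Finset.sum_congr rfl fun q _ => ha2 q
  calc Real.sqrt (∑ q ∈ S, Φ q * ‖fourierCoeff g q‖ ^ 2) ≤ Real.sqrt ((A + B) ^ 2) := Real.sqrt_le_sqrt hle
    _ = A + B := Real.sqrt_sq (add_nonneg hA0 hB0)
    _ ≤ Real.sqrt (∑ q ∈ S, Φ q * ‖fourierCoeff g₀ q‖ ^ 2) + ε := by rw [← hAe]; linarith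

/-- **Weighted Minkowski–Bessel, series form**: `‖g − g₀‖ ≤ ε` pointwise and `0 ≤ Φ ≤ 1` give
`√(Σ'Φ(q)‖ĝ(q)‖²) ≤ √(Σ'Φ(q)‖ĝ₀(q)‖²) + ε` (both series converge by Parseval). [cite: Grafakos2014, Prop. 3.2.7 (3)] -/
theorem sqrt_tsum_weight_sq_norm_fourierCoeff_le_of_near {g g₀ : UnitAddCircle → ℂ} (hg : Continuous g)
    (hg₀ : Continuous g₀) {ε : ℝ} (hε : ∀ x, ‖g x - g₀ x‖ ≤ ε) {Φ : ℤ → ℝ} (hΦ0 : ∀ q, 0 ≤ Φ q) (hΦ1 : ∀ q, Φ q ≤ 1) :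
    Real.sqrt (∑' q, Φ q * ‖fourierCoeff g q‖ ^ 2) ≤ Real.sqrt (∑' q, Φ q * ‖fourierCoeff g₀ q‖ ^ 2) + ε := by
  have hε0 : 0 ≤ ε := (norm_nonneg _).trans (hε 0)
  have hs₀ : Summable fun q => Φ q * ‖fourierCoeff g₀ q‖ ^ 2 :=
    Summable.of_nonneg_of_le (fun q => mul_nonneg (hΦ0 q) (sq_nonneg _))
      (fun q => mul_le_of_le_one_left (sq_nonneg _) (hΦ1 q)) (summable_sq_norm_fourierCoeff_of_continuous hg₀)
  set C := Real.sqrt (∑' q, Φ q * ‖fourierCoeff g₀ q‖ ^ 2) + ε with hC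
  have hC0 : 0 ≤ C := add_nonneg (Real.sqrt_nonneg _) hε0
  have hfin : ∀ S : Finset ℤ, ∑ q ∈ S, Φ q * ‖fourierCoeff g q‖ ^ 2 ≤ C ^ 2 := by
    intro S
    have h1 := sqrt_sum_weight_sq_norm_fourierCoeff_le_of_near hg hg₀ hε hΦ0 hΦ1 S
    have h2 : Real.sqrt (∑ q ∈ S, Φ q * ‖fourierCoeff g₀ q‖ ^ 2) ≤ Real.sqrt (∑' q, Φ q * ‖fourierCoeff g₀ q‖ ^ 2) :=
      Real.sqrt_le_sqrt (hs₀.sum_le_tsum S fun q _ => mul_nonneg (hΦ0 q) (sq_nonneg _))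
    have h3 : Real.sqrt (∑ q ∈ S, Φ q * ‖fourierCoeff g q‖ ^ 2) ≤ C := h1.trans (by rw [hC]; linarith)
    have h0 : 0 ≤ ∑ q ∈ S, Φ q * ‖fourierCoeff g q‖ ^ 2 := Finset.sum_nonneg fun q _ => mul_nonneg (hΦ0 q) (sq_nonneg _)
    calc ∑ q ∈ S, Φ q * ‖fourierCoeff g q‖ ^ 2 = Real.sqrt (∑ q ∈ S, Φ q * ‖fourierCoeff g q‖ ^ 2) ^ 2 :=
          (Real.sq_sqrt h0).symm
      _ ≤ C ^ 2 := pow_le_pow_left₀ (Real.sqrt_nonneg _) h3 2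
  have ht : ∑' q, Φ q * ‖fourierCoeff g q‖ ^ 2 ≤ C ^ 2 :=
    Real.tsum_le_of_sum_le (fun q => mul_nonneg (hΦ0 q) (sq_nonneg _)) hfin
  calc Real.sqrt (∑' q, Φ q * ‖fourierCoeff g q‖ ^ 2) ≤ Real.sqrt (C ^ 2) := Real.sqrt_le_sqrt ht
    _ = C := Real.sqrt_sq hC0

/-! ## §2 Regrouping by fibres and the chirp window functional -/

/-- The chirp window functional of fibre `n` is at most one: `Σ'_p W(p,n)‖ĝ_n(p + c)‖² ≤ 1` for `0 ≤ W ≤ 1`.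
[cite: Grafakos2014, Prop. 3.2.7 (3)] -/
theorem tsum_weight_chirp_le_one (ψ : ShearProfile) (n c : ℤ) {W : (Fin 2 → ℤ) → ℝ} (hW0 : ∀ k, 0 ≤ W k)
    (hW1 : ∀ k, W k ≤ 1) :
    ∑' p : ℤ, W (![p, n]) * ‖fourierCoeff (twist ψ n) (p + c)‖ ^ 2 ≤ 1 := by
  have hs := summable_sq_norm_fourierCoeff_twist_shift ψ n c
  calc ∑' p : ℤ, W (![p, n]) * ‖fourierCoeff (twist ψ n) (p + c)‖ ^ 2
      ≤ ∑' p : ℤ, ‖fourierCoeff (twist ψ n) (p + c)‖ ^ 2 :=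
        Summable.tsum_le_tsum (fun p => mul_le_of_le_one_left (sq_nonneg _) (hW1 _))
          (Summable.of_nonneg_of_le (fun p => mul_nonneg (hW0 _) (sq_nonneg _))
            (fun p => mul_le_of_le_one_left (sq_nonneg _) (hW1 _)) hs) hs
    _ = 1 := tsum_sq_norm_fourierCoeff_twist_shift ψ n c

/-- The chirp window functional is summable. [folklore] -/
theorem summable_weight_chirp (ψ : ShearProfile) (n c : ℤ) {W : (Fin 2 → ℤ) → ℝ} (hW0 : ∀ k, 0 ≤ W k)
    (hW1 : ∀ k, W k ≤ 1) : Summable fun p : ℤ => W (![p, n]) * ‖fourierCoeff (twist ψ n) (p + c)‖ ^ 2 :=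
  Summable.of_nonneg_of_le (fun _ => mul_nonneg (hW0 _) (sq_nonneg _))
    (fun _ => mul_le_of_le_one_left (sq_nonneg _) (hW1 _)) (summable_sq_norm_fourierCoeff_twist_shift ψ n c)

/-- **The chirp window functional under a low-pass**: if the weight of fibre `n` is supported where `|p + c| ≤ Q`, then
`Σ'_p W(p,n)‖ĝ_n(p+c)‖² ≤ Σ_{q=−Q}^{Q}‖ĝ_n(q)‖²`. [cite: Grafakos2014, Prop. 3.2.7 (3)] -/
theorem tsum_weight_chirp_le_lowpass (ψ : ShearProfile) (n c : ℤ) {W : (Fin 2 → ℤ) → ℝ}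
    (hW1 : ∀ k, W k ≤ 1) {Q : ℕ} (hsupp : ∀ p : ℤ, W (![p, n]) ≠ 0 → |p + c| ≤ Q) :
    ∑' p : ℤ, W (![p, n]) * ‖fourierCoeff (twist ψ n) (p + c)‖ ^ 2 ≤
      ∑ q ∈ Finset.Icc (-(Q : ℤ)) Q, ‖fourierCoeff (twist ψ n) q‖ ^ 2 := by
  classical
  -- the series is a finite sum over the shifted box
  set S : Finset ℤ := (Finset.Icc (-(Q : ℤ)) Q).image fun q => q - c with hS
  have hzero : ∀ p ∉ S, W (![p, n]) * ‖fourierCoeff (twist ψ n) (p + c)‖ ^ 2 = 0 := by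
    intro p hp
    by_cases hWp : W (![p, n]) = 0
    · rw [hWp, zero_mul]
    · exfalso
      refine hp ?_
      rw [hS, Finset.mem_image]
      refine ⟨p + c, ?_, by ring⟩
      rw [Finset.mem_Icc]
      exact abs_le.1 (hsupp p hWp)
  rw [tsum_eq_sum hzero]
  calc ∑ p ∈ S, W (![p, n]) * ‖fourierCoeff (twist ψ n) (p + c)‖ ^ 2
      ≤ ∑ p ∈ S, ‖fourierCoeff (twist ψ n) (p + c)‖ ^ 2 :=
        Finset.sum_le_sum fun p _ => mul_le_of_le_one_left (sq_nonneg _) (hW1 _)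
    _ = ∑ q ∈ Finset.Icc (-(Q : ℤ)) Q, ‖fourierCoeff (twist ψ n) q‖ ^ 2 := by
        rw [hS, Finset.sum_image (fun x _ y _ hxy => by simpa using hxy)]
        exact Finset.sum_congr rfl fun q _ => by rw [sub_add_cancel]

/-- **Regrouping the phase-one bound by fibres**: for `b₀ = datum ∘ Φ_H`, `a₁ = b₀ ∘ Φ_V` (profile `ψ`) and weights `0 ≤ W ≤ 1`,
`Σ'W‖𝓕a₁‖² ≤ ½(Σ'_n ‖ĝ_{−1}(n)‖²·Φ⁻_n + Σ'_n ‖ĝ₁(n)‖²·Φ⁺_n)` with `Φ^∓_n = Σ'_p W(p,n)‖ĝ_n(p ± 1)‖²`.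
[cite: Grafakos2014, Prop. 3.1.2 (5) and Prop. 3.2.7 (3)] -/
theorem tsum_weight_sq_norm_phaseOne_le_fibre (ψ : ShearProfile) {b a : UnitAddTorus (Fin 2) → ℝ}
    (hb : b = datum ∘ shearMap 0 1 ψ) (ha : a = b ∘ shearMap 1 0 ψ) {W : (Fin 2 → ℤ) → ℝ} (hW0 : ∀ k, 0 ≤ W k)
    (hW1 : ∀ k, W k ≤ 1) :
    ∑' k : Fin 2 → ℤ, W k * ‖mFourierCoeff (fun x => (a x : ℂ)) k‖ ^ 2 ≤
      1 / 2 * ((∑' n : ℤ, ‖fourierCoeff (twist ψ (-1)) n‖ ^ 2 *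
          ∑' p : ℤ, W (![p, n]) * ‖fourierCoeff (twist ψ n) (p + 1)‖ ^ 2) +
        ∑' n : ℤ, ‖fourierCoeff (twist ψ 1) n‖ ^ 2 *
          ∑' p : ℤ, W (![p, n]) * ‖fourierCoeff (twist ψ n) (p - 1)‖ ^ 2) := by
  have h := tsum_weight_sq_norm_phaseOne_le ψ hb ha hW0 hW1
  refine h.trans (le_of_eq ?_)
  congr 1
  -- the `ℤ × ℤ` series regrouped
  set T : ℤ × ℤ → ℝ := fun q => W (![q.2, q.1]) *
    (‖fourierCoeff (twist ψ q.1) (q.2 + 1)‖ ^ 2 * ‖fourierCoeff (twist ψ (-1)) q.1‖ ^ 2 +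
      ‖fourierCoeff (twist ψ q.1) (q.2 - 1)‖ ^ 2 * ‖fourierCoeff (twist ψ 1) q.1‖ ^ 2) with hT
  have hM := hasSum_phaseOne_majorant ψ
  have hT0 : ∀ q, 0 ≤ T q := fun q => mul_nonneg (hW0 _) (by positivity)
  have hTs : Summable T := Summable.of_nonneg_of_le hT0
    (fun q => mul_le_of_le_one_left (by positivity) (hW1 _)) hM.summable
  change ∑' q : ℤ × ℤ, T q = _
  rw [hTs.tsum_prod]
  -- fibrewise: the inner sums
  have hsm : ∀ n : ℤ, Summable fun p : ℤ => W (![p, n]) * ‖fourierCoeff (twist ψ n) (p - 1)‖ ^ 2 := fun n => by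
    simpa [sub_eq_add_neg] using summable_weight_chirp ψ n (-1) hW0 hW1
  have hinner : ∀ n : ℤ, ∑' p : ℤ, T (n, p) =
      ‖fourierCoeff (twist ψ (-1)) n‖ ^ 2 * ∑' p : ℤ, W (![p, n]) * ‖fourierCoeff (twist ψ n) (p + 1)‖ ^ 2 +
        ‖fourierCoeff (twist ψ 1) n‖ ^ 2 * ∑' p : ℤ, W (![p, n]) * ‖fourierCoeff (twist ψ n) (p - 1)‖ ^ 2 := by
    intro n
    have h1 := (summable_weight_chirp ψ n 1 hW0 hW1).mul_left (‖fourierCoeff (twist ψ (-1)) n‖ ^ 2)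
    have h2 := (hsm n).mul_left (‖fourierCoeff (twist ψ 1) n‖ ^ 2)
    rw [← tsum_mul_left, ← tsum_mul_left, ← h1.tsum_add h2]
    exact tsum_congr fun p => by simp only [hT]; ring
  simp_rw [hinner]
  -- summability of the two fibre series (`Φ ≤ 1`)
  have hΦ0 : ∀ (n c : ℤ), 0 ≤ ∑' p : ℤ, W (![p, n]) * ‖fourierCoeff (twist ψ n) (p + c)‖ ^ 2 := fun n c =>
    tsum_nonneg fun p => mul_nonneg (hW0 _) (sq_nonneg _)
  have hw : ∀ c : ℤ, Summable fun n : ℤ => ‖fourierCoeff (twist ψ c) n‖ ^ 2 := fun c =>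
    (hasSum_sq_norm_fourierCoeff_twist ψ c).summable
  have hs1 : Summable fun n : ℤ => ‖fourierCoeff (twist ψ (-1)) n‖ ^ 2 *
      ∑' p : ℤ, W (![p, n]) * ‖fourierCoeff (twist ψ n) (p + 1)‖ ^ 2 :=
    Summable.of_nonneg_of_le (fun n => mul_nonneg (sq_nonneg _) (hΦ0 n 1))
      (fun n => mul_le_of_le_one_right (sq_nonneg _) (tsum_weight_chirp_le_one ψ n 1 hW0 hW1)) (hw (-1))
  have hs2 : Summable fun n : ℤ => ‖fourierCoeff (twist ψ 1) n‖ ^ 2 *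
      ∑' p : ℤ, W (![p, n]) * ‖fourierCoeff (twist ψ n) (p - 1)‖ ^ 2 := by
    refine Summable.of_nonneg_of_le (fun n => mul_nonneg (sq_nonneg _) ?_) (fun n => mul_le_of_le_one_right (sq_nonneg _) ?_)
      (hw 1)
    · simpa [sub_eq_add_neg] using hΦ0 n (-1)
    · simpa [sub_eq_add_neg] using tsum_weight_chirp_le_one ψ n (-1) hW0 hW1
  exact hs1.tsum_add hs2

/-! ## §3 The phase-one start inequality with EXACT chirp weights -/

/-- **Exact weights for the fibre sums**: for a chirp `g = twist ψ σ` within `2πη` of a continuous `g₀` (in the sense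
`|σ·ψ(t) − λ·tri(2πt)/(2π)| ≤ η`) and fibre functionals `0 ≤ Φ ≤ 1`,
`Σ'_n ‖ĝ(n)‖²Φ_n ≤ (√(Σ'_n ‖ĝ₀(n)‖²Φ_n) + 2πη)²`. [cite: Grafakos2014, Prop. 3.2.7 (3)] -/
theorem tsum_sq_norm_twist_mul_le (ψ : ShearProfile) (σ lam : ℤ) {g₀ : UnitAddCircle → ℂ}
    (hg₀ : ∀ t : ℝ, g₀ (t : UnitAddCircle) = Complex.exp (-(2 * π * I * lam * ((tri (2 * π * t) / (2 * π) : ℝ) : ℂ))))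
    (hg₀c : Continuous g₀) {η : ℝ} (hη : ∀ t : ℝ, |σ * ψ t - lam * (tri (2 * π * t) / (2 * π))| ≤ η)
    {Φ : ℤ → ℝ} (hΦ0 : ∀ n, 0 ≤ Φ n) (hΦ1 : ∀ n, Φ n ≤ 1) :
    ∑' n : ℤ, ‖fourierCoeff (twist ψ σ) n‖ ^ 2 * Φ n ≤
      (Real.sqrt (∑' n : ℤ, ‖fourierCoeff g₀ n‖ ^ 2 * Φ n) + 2 * π * η) ^ 2 := by
  -- pointwise closeness of the two chirps
  have hnear : ∀ x : UnitAddCircle, ‖twist ψ σ x - g₀ x‖ ≤ 2 * π * η := by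
    intro x
    obtain ⟨t, rfl⟩ := QuotientAddGroup.mk_surjective x
    rw [twist_coe, hg₀ t]
    have h := norm_exp_neg_two_pi_I_sub_le (σ * ψ t) (lam * (tri (2 * π * t) / (2 * π)))
    have e1 : Complex.exp (-(2 * π * I * ((σ * ψ t : ℝ) : ℂ))) = Complex.exp (-(2 * Real.pi * Complex.I * σ * ψ t)) := by
      congr 1; push_cast; ring
    have e2 : Complex.exp (-(2 * π * I * ((lam * (tri (2 * π * t) / (2 * π)) : ℝ) : ℂ))) =
        Complex.exp (-(2 * π * I * lam * ((tri (2 * π * t) / (2 * π) : ℝ) : ℂ))) := by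
      congr 1; push_cast; ring
    rw [e1, e2] at h
    exact h.trans (by nlinarith [hη t, Real.pi_pos, abs_nonneg (σ * ψ t - lam * (tri (2 * π * t) / (2 * π)))])
  have hηπ : 0 ≤ 2 * π * η := (norm_nonneg _).trans (hnear 0)
  have h := sqrt_tsum_weight_sq_norm_fourierCoeff_le_of_near (continuous_twist ψ σ) hg₀c hnear hΦ0 hΦ1
  have hcomm : ∀ (f : UnitAddCircle → ℂ), (fun n : ℤ => ‖fourierCoeff f n‖ ^ 2 * Φ n) = fun n => Φ n * ‖fourierCoeff f n‖ ^ 2 :=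
    fun f => funext fun n => mul_comm _ _
  rw [hcomm, hcomm]
  have h0 : 0 ≤ ∑' n : ℤ, Φ n * ‖fourierCoeff (twist ψ σ) n‖ ^ 2 := tsum_nonneg fun n => mul_nonneg (hΦ0 n) (sq_nonneg _)
  calc ∑' n : ℤ, Φ n * ‖fourierCoeff (twist ψ σ) n‖ ^ 2
      = Real.sqrt (∑' n : ℤ, Φ n * ‖fourierCoeff (twist ψ σ) n‖ ^ 2) ^ 2 := (Real.sq_sqrt h0).symm
    _ ≤ (Real.sqrt (∑' n : ℤ, Φ n * ‖fourierCoeff g₀ n‖ ^ 2) + 2 * π * η) ^ 2 :=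
        pow_le_pow_left₀ (Real.sqrt_nonneg _) h 2

/-- **THE PHASE-ONE START INEQUALITY.**  For any profile `ψ`, `b₀ = datum ∘ Φ_H(ψ)`, `a₁ = b₀ ∘ Φ_V(ψ)`, weights `0 ≤ W ≤ 1`, and
the exact one-tooth chirps `g₀⁺, g₀⁻` of frequencies `λ, −λ` with `|ψ(t) − λ·tri(2πt)/(2π)| ≤ η` (for the cascade: `ψ = γU₀`,
`λ = γ ∈ ℤ`, `η = γ(2e^{1/2}−1)δ₀/(2π)` by `abs_U_sub_exactProfile_le`):
`Σ'W‖𝓕a₁‖² ≤ ½[(√(Σ'_n‖ĝ₀⁻(n)‖²Φ⁻_n) + 2πη)² + (√(Σ'_n‖ĝ₀⁺(n)‖²Φ⁺_n) + 2πη)²]`, `Φ^∓_n = Σ'_pW(p,n)‖ĝ_n(p±1)‖² ∈ [0,1]`.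
[cite: Grafakos2014, Prop. 3.1.2 (5) and Prop. 3.2.7 (3)] -/
theorem tsum_weight_sq_norm_phaseOne_le_exact (ψ : ShearProfile) {b a : UnitAddTorus (Fin 2) → ℝ}
    (hb : b = datum ∘ shearMap 0 1 ψ) (ha : a = b ∘ shearMap 1 0 ψ) {W : (Fin 2 → ℤ) → ℝ} (hW0 : ∀ k, 0 ≤ W k)
    (hW1 : ∀ k, W k ≤ 1) (lam : ℤ) {gp gm : UnitAddCircle → ℂ}
    (hgp : ∀ t : ℝ, gp (t : UnitAddCircle) = Complex.exp (-(2 * π * I * lam * ((tri (2 * π * t) / (2 * π) : ℝ) : ℂ))))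
    (hgm : ∀ t : ℝ, gm (t : UnitAddCircle) = Complex.exp (-(2 * π * I * (-lam) * ((tri (2 * π * t) / (2 * π) : ℝ) : ℂ))))
    (hgpc : Continuous gp) (hgmc : Continuous gm) {η : ℝ} (hη : ∀ t : ℝ, |ψ t - lam * (tri (2 * π * t) / (2 * π))| ≤ η) :
    ∑' k : Fin 2 → ℤ, W k * ‖mFourierCoeff (fun x => (a x : ℂ)) k‖ ^ 2 ≤
      1 / 2 * ((Real.sqrt (∑' n : ℤ, ‖fourierCoeff gm n‖ ^ 2 *
            ∑' p : ℤ, W (![p, n]) * ‖fourierCoeff (twist ψ n) (p + 1)‖ ^ 2) + 2 * π * η) ^ 2 +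
        (Real.sqrt (∑' n : ℤ, ‖fourierCoeff gp n‖ ^ 2 *
            ∑' p : ℤ, W (![p, n]) * ‖fourierCoeff (twist ψ n) (p - 1)‖ ^ 2) + 2 * π * η) ^ 2) := by
  have h := tsum_weight_sq_norm_phaseOne_le_fibre ψ hb ha hW0 hW1
  refine h.trans ?_
  have hηp : ∀ t : ℝ, |(1 : ℤ) * ψ t - lam * (tri (2 * π * t) / (2 * π))| ≤ η := fun t => by simpa using hη t
  have hηm : ∀ t : ℝ, |(-1 : ℤ) * ψ t - (-lam) * (tri (2 * π * t) / (2 * π))| ≤ η := fun t => by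
    have : ((-1 : ℤ) : ℝ) * ψ t - (-lam) * (tri (2 * π * t) / (2 * π)) = -(ψ t - lam * (tri (2 * π * t) / (2 * π))) := by
      push_cast; ring
    rw [this, abs_neg]; exact hη t
  have hΦp0 : ∀ n : ℤ, 0 ≤ ∑' p : ℤ, W (![p, n]) * ‖fourierCoeff (twist ψ n) (p - 1)‖ ^ 2 := fun n =>
    tsum_nonneg fun p => mul_nonneg (hW0 _) (sq_nonneg _)
  have hΦp1 : ∀ n : ℤ, ∑' p : ℤ, W (![p, n]) * ‖fourierCoeff (twist ψ n) (p - 1)‖ ^ 2 ≤ 1 := fun n => by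
    simpa [sub_eq_add_neg] using tsum_weight_chirp_le_one ψ n (-1) hW0 hW1
  have hΦm0 : ∀ n : ℤ, 0 ≤ ∑' p : ℤ, W (![p, n]) * ‖fourierCoeff (twist ψ n) (p + 1)‖ ^ 2 := fun n =>
    tsum_nonneg fun p => mul_nonneg (hW0 _) (sq_nonneg _)
  have hΦm1 : ∀ n : ℤ, ∑' p : ℤ, W (![p, n]) * ‖fourierCoeff (twist ψ n) (p + 1)‖ ^ 2 ≤ 1 := fun n =>
    tsum_weight_chirp_le_one ψ n 1 hW0 hW1
  have hgm' : ∀ t : ℝ, gm (t : UnitAddCircle) = Complex.exp (-(2 * π * I * ((-lam : ℤ)) * ((tri (2 * π * t) / (2 * π) : ℝ) : ℂ))) :=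
    fun t => by rw [hgm t]; push_cast; ring_nf
  have h1 := tsum_sq_norm_twist_mul_le ψ (-1) (-lam) hgm' hgmc (by simpa using hηm) hΦm0 hΦm1
  have h2 := tsum_sq_norm_twist_mul_le ψ 1 lam hgp hgpc (by simpa using hηp) hΦp0 hΦp1
  linarith

end Summit.AnomalousDissipation.AnomalousDissipation.Theorems.SawtoothPulseCascade.K1Start
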